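import Summits.ValiantsHypothesis.ValiantsHypothesis.Theorems.KPlusLogSqLawTropicalBSingleGaugeLevelMajor

/-!
# Route «KPlusLogSqLaw», crux `TropicalB` (stmt-ValiantsHypothesis-19771) — SINGLE-GAUGE CEILING, LEVEL-MAJOR CASE, EVERY `K ≥ 3`:
# a chain certified by one level-major gauge of type `(1, K−2, 1)` has `n ≤ (K−3)·m² + 2m` — DIAMOND(`K−3`) is optimal for its gauge type

HONEST FRAMING.  Helper `--supports` the crux `Summit.ValiantsHypothesis.ValiantsHypothesis.Theses.KPlusLogSqLaw.TropicalB`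
(item stmt-ValiantsHypothesis-19771, route KPlusLogSqLaw, DRAFT; cell `pub-symmetroid`, seat val-sym-trop-p5 g11, 2026-08-27).  The all-`K`
form of `SingleGauge.chain_le_of_levelMajorGauge` (same seat, `K = 4`); a STRUCTURE theorem about dominant chains of arbitrary designs with
`K = a + 3` classes that admit a column-wise certificate by one affine row gauge of LEVEL-MAJOR type `(1, a+1, 1)` — class `0` block, then the
`a+1` middle classes row by row, then the top class (DIAMOND(`a`)'s gauge `u_r = −κθr` with `d = (0, D, D+1, …, D+a, 2D)`, `D = mκ`, `κ > a`).
Nothing here bears on `TropicalB` in its window, `WeakLifting`, the doors, `MatrixDescartes` (stmt-ValiantsHypothesis-18050) or VP ≠ VNP.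

* `chain_le_of_levelMajorGaugeK` — **such a chain has `n ≤ m·(a·m + 2) = (K−3)m² + 2m`**, DIAMOND(`a`)'s own count
  (`…TropicalShiftDiamondChain`: `T(m, a+3) ≥ a·m² + 2m`), against `m(mK − 1)` from the general single-gauge law (p554764).
Proof: the rank potential `ψ = (a·m+2 | a(m−ρ)+2−l for the middle class l = 1..a+1 | 0)` (`psi_dropK`: by LEVELS, the weight never rises
along a certified column and drops by `≥ 1` unless the row's `α` decreased; `gslope_injK`; then verbatim the `K = 4` telescoping).
[this seat; the located all-gauge law `(K−3)m² + 2m` (memo SINGLE-GAUGE-CEILING-g11, evidence on the item) is NOT claimed here.]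
-/

set_option linter.dupNamespace false
set_option autoImplicit false

namespace Summit.ValiantsHypothesis.ValiantsHypothesis.Theorems.KPlusLogSqLaw

open Summit.ValiantsHypothesis.ValiantsHypothesis.Theorems.MatrixDescartes.Negative
open scoped BigOperators
open Finset

namespace SingleGauge

variable {m a : ℕ}

/-- first middle class `1`, last middle class `a+1`, top class `a+2` of `Fin (a+3)`. -/
theorem val_cls1 : ((⟨1, by omega⟩ : Fin (a + 3)) : ℕ) = 1 := rfl

/-- Under a level-major gauge of type `(1, a+1, 1)` the gauged slope determines the incidence type. -/
theorem gslope_injK {d : Fin (a + 3) → ℕ} {α : Fin m → ℚ} (hinj : Function.Injective α) (hd : StrictMono d)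
    (h01 : ∀ i i', (d 0 : ℚ) - α i < (d ⟨1, by omega⟩ : ℚ) - α i')
    (h23 : ∀ i i', (d ⟨a + 1, by omega⟩ : ℚ) - α i < (d ⟨a + 2, by omega⟩ : ℚ) - α i')
    (hlo : ∀ i i', α i' < α i → (d ⟨a + 1, by omega⟩ : ℚ) - α i < (d ⟨1, by omega⟩ : ℚ) - α i')
    {i i' : Fin m} {l l' : Fin (a + 3)} (he : (d l : ℚ) - α i = (d l' : ℚ) - α i') : i = i' ∧ l = l' := by
  have hdm : ∀ x y : Fin (a + 3), (x : ℕ) ≤ (y : ℕ) → (d x : ℚ) ≤ (d y : ℚ) := fun x y hxy => by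
    exact_mod_cast hd.monotone (Fin.le_def.mpr hxy)
  -- bounds placing every class in its block
  have lo1 : ∀ (x : Fin (a + 3)) (r : Fin m), 1 ≤ (x : ℕ) → (d ⟨1, by omega⟩ : ℚ) - α r ≤ (d x : ℚ) - α r :=
    fun x r hx => by linarith [hdm ⟨1, by omega⟩ x hx]
  have hi1 : ∀ (x : Fin (a + 3)) (r : Fin m), (x : ℕ) ≤ a + 1 → (d x : ℚ) - α r ≤ (d ⟨a + 1, by omega⟩ : ℚ) - α r :=
    fun x r hx => by linarith [hdm x ⟨a + 1, by omega⟩ hx]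
  have top : ∀ (x : Fin (a + 3)) (r : Fin m), (x : ℕ) = a + 2 → (d x : ℚ) = (d ⟨a + 2, by omega⟩ : ℚ) :=
    fun x r hx => by have : x = ⟨a + 2, by omega⟩ := Fin.ext hx; rw [this]
  have bot : ∀ (x : Fin (a + 3)), (x : ℕ) = 0 → (d x : ℚ) = (d 0 : ℚ) := fun x hx => by
    have : x = 0 := Fin.ext hx; rw [this]
  have hl : (l : ℕ) < a + 3 := l.isLt
  have hl' : (l' : ℕ) < a + 3 := l'.isLt
  -- same level is forced
  by_cases hl0 : (l : ℕ) = 0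
  · by_cases hl'0 : (l' : ℕ) = 0
    · have hll : l = l' := Fin.ext (by omega)
      subst hll; exact ⟨hinj (by linarith), rfl⟩
    · exfalso; rw [bot l hl0] at he
      by_cases hl't : (l' : ℕ) = a + 2
      · rw [top l' i' hl't] at he; linarith [h01 i i', hi1 ⟨1, by omega⟩ i' (by simp), h23 i' i']
      · linarith [h01 i i', lo1 l' i' (by omega)]
  by_cases hl't0 : (l' : ℕ) = 0
  · exfalso; rw [bot l' hl't0] at he
    by_cases hlt : (l : ℕ) = a + 2
    · rw [top l i hlt] at he; linarith [h01 i' i, hi1 ⟨1, by omega⟩ i (by simp), h23 i i]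
    · linarith [h01 i' i, lo1 l i (by omega)]
  by_cases hlt : (l : ℕ) = a + 2
  · by_cases hl't : (l' : ℕ) = a + 2
    · have hll : l = l' := Fin.ext (by omega)
      subst hll; exact ⟨hinj (by linarith), rfl⟩
    · exfalso; rw [top l i hlt] at he; linarith [h23 i' i, hi1 l' i' (by omega)]
  by_cases hl't : (l' : ℕ) = a + 2
  · exfalso; rw [top l' i' hl't] at he; linarith [h23 i i', hi1 l i (by omega)]
  -- both in the middle block
  rcases lt_trichotomy (α i) (α i') with hab | hab | hab
  · exfalso; linarith [hlo i' i hab, hi1 l' i' (by omega), lo1 l i (by omega)]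
  · have hii : i = i' := hinj hab
    subst hii
    have hdd : (d l : ℚ) = (d l' : ℚ) := by linarith
    exact ⟨rfl, hd.injective (by exact_mod_cast hdd)⟩
  · exfalso; linarith [hlo i i' hab, hi1 l i (by omega), lo1 l' i' (by omega)]

/-- **Per-column drop, type `(1, a+1, 1)`.**  For any weight `P = (a·m+2 | a(m−R)+2−l | 0)` with `R` a rank function of the gauge: if the gauged
slope strictly increases from incidence type `(i,l)` to `(i',l')`, then `P` does not increase, and drops by `≥ 1` unless `α i' < α i`. -/
theorem psi_dropK {d : Fin (a + 3) → ℕ} {α : Fin m → ℚ} (hd : StrictMono d)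
    (h01 : ∀ i i', (d 0 : ℚ) - α i < (d ⟨1, by omega⟩ : ℚ) - α i')
    (h23 : ∀ i i', (d ⟨a + 1, by omega⟩ : ℚ) - α i < (d ⟨a + 2, by omega⟩ : ℚ) - α i')
    (hlo : ∀ i i', α i' < α i → (d ⟨a + 1, by omega⟩ : ℚ) - α i < (d ⟨1, by omega⟩ : ℚ) - α i')
    (R : Fin m → ℤ) (hRnn : ∀ i, 0 ≤ R i) (hRlt : ∀ i, R i + 1 ≤ (m : ℤ)) (hRup : ∀ i i', α i' < α i → R i + 1 ≤ R i')
    (hReq : ∀ i i', α i = α i' → R i = R i')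
    (P : Fin m → Fin (a + 3) → ℤ) (hP0 : ∀ (i : Fin m) (l : Fin (a + 3)), (l : ℕ) = 0 → P i l = (a : ℤ) * m + 2)
    (hP1 : ∀ (i : Fin m) (l : Fin (a + 3)), 1 ≤ (l : ℕ) → (l : ℕ) ≤ a + 1 → P i l = (a : ℤ) * ((m : ℤ) - R i) + 2 - (l : ℕ))
    (hP2 : ∀ (i : Fin m) (l : Fin (a + 3)), (l : ℕ) = a + 2 → P i l = 0)
    {i i' : Fin m} {l l' : Fin (a + 3)} (hlt : (d l : ℚ) - α i < (d l' : ℚ) - α i') :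
    P i' l' ≤ P i l ∧ (α i ≤ α i' → P i' l' + 1 ≤ P i l) := by
  have hdm : ∀ x y : Fin (a + 3), (x : ℕ) ≤ (y : ℕ) → (d x : ℚ) ≤ (d y : ℚ) := fun x y hxy => by
    exact_mod_cast hd.monotone (Fin.le_def.mpr hxy)
  have hds : ∀ x y : Fin (a + 3), (x : ℕ) < (y : ℕ) → (d x : ℚ) < (d y : ℚ) := fun x y hxy => by
    exact_mod_cast hd (Fin.lt_def.mpr hxy)
  have lo1 : ∀ (x : Fin (a + 3)) (r : Fin m), 1 ≤ (x : ℕ) → (d ⟨1, by omega⟩ : ℚ) - α r ≤ (d x : ℚ) - α r :=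
    fun x r hx => by linarith [hdm ⟨1, by omega⟩ x hx]
  have hi1 : ∀ (x : Fin (a + 3)) (r : Fin m), (x : ℕ) ≤ a + 1 → (d x : ℚ) - α r ≤ (d ⟨a + 1, by omega⟩ : ℚ) - α r :=
    fun x r hx => by linarith [hdm x ⟨a + 1, by omega⟩ hx]
  have top : ∀ (x : Fin (a + 3)), (x : ℕ) = a + 2 → (d x : ℚ) = (d ⟨a + 2, by omega⟩ : ℚ) := fun x hx => by
    have : x = ⟨a + 2, by omega⟩ := Fin.ext hx; rw [this]
  have bot : ∀ (x : Fin (a + 3)), (x : ℕ) = 0 → (d x : ℚ) = (d 0 : ℚ) := fun x hx => by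
    have : x = 0 := Fin.ext hx; rw [this]
  have hr1 := hRlt i; have hr2 := hRnn i; have hr1' := hRlt i'; have hr2' := hRnn i'
  have hl : (l : ℕ) < a + 3 := l.isLt
  have hl' : (l' : ℕ) < a + 3 := l'.isLt
  have ha : (0 : ℤ) ≤ a := by positivity
  have hRm : (a : ℤ) * ((m : ℤ) - R i) ≥ a := by nlinarith
  have hRm' : (a : ℤ) * ((m : ℤ) - R i') ≥ a := by nlinarith
  -- case on the new level
  by_cases hn0 : (l' : ℕ) = 0
  · -- new class 0: old class 0 and α decreased
    by_cases ho0 : (l : ℕ) = 0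
    · rw [hP0 i' l' hn0, hP0 i l ho0]; rw [bot l ho0, bot l' hn0] at hlt
      refine ⟨le_rfl, fun hle => ?_⟩; exfalso; linarith
    · exfalso; rw [bot l' hn0] at hlt
      by_cases hot : (l : ℕ) = a + 2
      · rw [top l hot] at hlt; linarith [h01 i' i, hi1 ⟨1, by omega⟩ i (by simp), h23 i i]
      · linarith [h01 i' i, lo1 l i (by omega)]
  by_cases hnt : (l' : ℕ) = a + 2
  · -- new top class: P new = 0; old weight ≥ 1 unless old top (then α decreased)
    rw [hP2 i' l' hnt]
    by_cases hot : (l : ℕ) = a + 2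
    · rw [hP2 i l hot]; rw [top l hot, top l' hnt] at hlt
      refine ⟨le_rfl, fun hle => ?_⟩; exfalso; linarith
    by_cases ho0 : (l : ℕ) = 0
    · rw [hP0 i l ho0]; constructor <;> [skip; intro] <;> nlinarith
    · rw [hP1 i l (by omega) (by omega)]
      have : ((l : ℕ) : ℤ) ≤ a + 1 := by exact_mod_cast (show (l : ℕ) ≤ a + 1 by omega)
      constructor <;> [skip; intro] <;> nlinarith
  -- new middle class
  have hn1 : 1 ≤ (l' : ℕ) := by omega
  have hn2 : (l' : ℕ) ≤ a + 1 := by omega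
  rw [hP1 i' l' hn1 hn2]
  have hl'z : ((l' : ℕ) : ℤ) ≤ a + 1 := by exact_mod_cast hn2
  have hl'z1 : (1 : ℤ) ≤ ((l' : ℕ) : ℤ) := by exact_mod_cast hn1
  by_cases ho0 : (l : ℕ) = 0
  · rw [hP0 i l ho0]
    constructor <;> [skip; intro] <;> nlinarith
  by_cases hot : (l : ℕ) = a + 2
  · exfalso; rw [top l hot] at hlt; linarith [h23 i' i, hi1 l' i' hn2]
  have ho1 : 1 ≤ (l : ℕ) := by omega
  have ho2 : (l : ℕ) ≤ a + 1 := by omega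
  rw [hP1 i l ho1 ho2]
  have hlz : ((l : ℕ) : ℤ) ≤ a + 1 := by exact_mod_cast ho2
  have hlz1 : (1 : ℤ) ≤ ((l : ℕ) : ℤ) := by exact_mod_cast ho1
  rcases lt_trichotomy (α i) (α i') with hab | hab | hab
  · exfalso; linarith [hlo i' i hab, hi1 l' i' hn2, lo1 l i ho1]
  · -- same row: class strictly up
    have hR := hReq i i' hab
    have hdl : (d l : ℚ) < (d l' : ℚ) := by linarith
    have hll : (l : ℕ) < (l' : ℕ) := by
      by_contra hc; push Not at hc; linarith [hdm l' l hc]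
    have hllz : ((l : ℕ) : ℤ) + 1 ≤ ((l' : ℕ) : ℤ) := by exact_mod_cast hll
    constructor <;> [skip; intro] <;> nlinarith
  · -- new row later in the gauge: rank up by ≥ 1, and the premise α i ≤ α i' is false
    have hR := hRup i i' hab
    refine ⟨by nlinarith, fun hle => absurd hle (not_le.mpr hab)⟩

/-- **SINGLE-GAUGE CEILING, LEVEL-MAJOR CASE, ALL `K ≥ 3`.**  A dominant chain with `K = a + 3` classes and distinct consecutive terms,
certified column-wise at every time by ONE affine row gauge (hypothesis `hcert` verbatim of `chain_le_of_singleGauge`) that is LEVEL-MAJOR of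
type `(1, a+1, 1)` — `α` injective, `d` strictly increasing, the class-`0` block below the middle block below the top class, and inside the middle
block each row's classes before the next row's (`hlo`) — has `n ≤ m·(a·m + 2) = (K−3)m² + 2m`: DIAMOND(`a`)'s count. [this seat] -/
theorem chain_le_of_levelMajorGaugeK (d : Fin (a + 3) → ℕ) (v ε : Fin m → Fin m → Fin (a + 3) → ℤ) (α β : Fin m → ℚ)
    (hinj : Function.Injective α) (hd : StrictMono d)
    (h01 : ∀ i i', (d 0 : ℚ) - α i < (d ⟨1, by omega⟩ : ℚ) - α i')
    (h23 : ∀ i i', (d ⟨a + 1, by omega⟩ : ℚ) - α i < (d ⟨a + 2, by omega⟩ : ℚ) - α i')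
    (hlo : ∀ i i', α i' < α i → (d ⟨a + 1, by omega⟩ : ℚ) - α i < (d ⟨1, by omega⟩ : ℚ) - α i')
    {n : ℕ} (θ : Fin (n + 1) → ℤ) (hθ : StrictMono θ) (p : Fin (n + 1) → Equiv.Perm (Fin m) × (Fin m → Fin (a + 3)))
    (hdom : ∀ k, IsDominant d v ε (θ k) (p k)) (hne : ∀ k : Fin n, p k.castSucc ≠ p k.succ)
    (hcert : ∀ (k : Fin (n + 1)) (j i : Fin m) (l : Fin (a + 3)), ε i j l ≠ 0 →
      ((θ k : ℚ) * (d l : ℚ) - (v i j l : ℚ)) - (α i * (θ k : ℚ) + β i) ≤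
        ((θ k : ℚ) * (d ((p k).2 j) : ℚ) - (v ((p k).1 j) j ((p k).2 j) : ℚ)) - (α ((p k).1 j) * (θ k : ℚ) + β ((p k).1 j))) :
    n ≤ m * (a * m + 2) := by
  let R : Fin m → ℤ := fun i => (((univ.filter fun x => α i < α x).card : ℕ) : ℤ)
  let P : Fin m → Fin (a + 3) → ℤ := fun i l =>
    if (l : ℕ) = 0 then (a : ℤ) * m + 2 else if (l : ℕ) ≤ a + 1 then (a : ℤ) * ((m : ℤ) - R i) + 2 - (l : ℕ) else 0
  have hRnn : ∀ i, 0 ≤ R i := fun i => by positivity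
  have hRlt : ∀ i, R i + 1 ≤ (m : ℤ) := fun i => rankCard_lt α i
  have hRup : ∀ i i', α i' < α i → R i + 1 ≤ R i' := fun i i' h => rankCard_lt_rankCard α h
  have hReq : ∀ i i', α i = α i' → R i = R i' := fun i i' h => by simp only [R, h]
  have hP0 : ∀ (i : Fin m) (l : Fin (a + 3)), (l : ℕ) = 0 → P i l = (a : ℤ) * m + 2 := fun i l h => by
    simp only [P, h, if_true]
  have hP1 : ∀ (i : Fin m) (l : Fin (a + 3)), 1 ≤ (l : ℕ) → (l : ℕ) ≤ a + 1 →
      P i l = (a : ℤ) * ((m : ℤ) - R i) + 2 - (l : ℕ) := fun i l h1 h2 => by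
    have hne : (l : ℕ) ≠ 0 := by omega
    simp only [P, hne, if_false, h2, if_true]
  have hP2 : ∀ (i : Fin m) (l : Fin (a + 3)), (l : ℕ) = a + 2 → P i l = 0 := fun i l h => by
    have hne : (l : ℕ) ≠ 0 := by omega
    have hnl : ¬ ((l : ℕ) ≤ a + 1) := by omega
    simp only [P, hne, if_false, hnl]
  have ha : (0 : ℤ) ≤ a := by positivity
  have hPnn : ∀ (i : Fin m) (l : Fin (a + 3)), 0 ≤ P i l := by
    intro i l; have h1 := hRnn i; have h2 := hRlt i; have hl := l.isLt
    by_cases h0 : (l : ℕ) = 0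
    · rw [hP0 i l h0]; nlinarith
    by_cases ht : (l : ℕ) = a + 2
    · rw [hP2 i l ht]
    · rw [hP1 i l (by omega) (by omega)]
      have : ((l : ℕ) : ℤ) ≤ a + 1 := by exact_mod_cast (show (l : ℕ) ≤ a + 1 by omega)
      nlinarith
  have hPle : ∀ (i : Fin m) (l : Fin (a + 3)), P i l ≤ (a : ℤ) * m + 2 := by
    intro i l; have h1 := hRnn i; have hl := l.isLt
    by_cases h0 : (l : ℕ) = 0
    · rw [hP0 i l h0]
    by_cases ht : (l : ℕ) = a + 2
    · rw [hP2 i l ht]; nlinarith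
    · rw [hP1 i l (by omega) (by omega)]
      have : (1 : ℤ) ≤ ((l : ℕ) : ℤ) := by exact_mod_cast (show 1 ≤ (l : ℕ) by omega)
      nlinarith
  let Φ : Fin (n + 1) → ℤ := fun k => ∑ j, P ((p k).1 j) ((p k).2 j)
  have hstep : ∀ k : Fin n, Φ k.succ + 1 ≤ Φ k.castSucc := by
    intro k
    set a' := k.castSucc with ha'
    set b := k.succ with hb
    have hab : θ a' < θ b := hθ (Fin.castSucc_lt_succ (i := k))
    have habQ : (θ a' : ℚ) < (θ b : ℚ) := by exact_mod_cast hab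
    have hcol : ∀ j, P ((p b).1 j) ((p b).2 j) ≤ P ((p a').1 j) ((p a').2 j) ∧
        (((p a').1 j ≠ (p b).1 j ∨ (p a').2 j ≠ (p b).2 j) → α ((p a').1 j) ≤ α ((p b).1 j) →
          P ((p b).1 j) ((p b).2 j) + 1 ≤ P ((p a').1 j) ((p a').2 j)) := by
      intro j
      have e1 := eps_ne_zero_of_isDominant (hdom a') j
      have e2 := eps_ne_zero_of_isDominant (hdom b) j
      have c1 := hcert a' j ((p b).1 j) ((p b).2 j) e2
      have c2 := hcert b j ((p a').1 j) ((p a').2 j) e1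
      have hmono : (d ((p a').2 j) : ℚ) - α ((p a').1 j) ≤ (d ((p b).2 j) : ℚ) - α ((p b).1 j) := by nlinarith
      by_cases hch : (p a').1 j ≠ (p b).1 j ∨ (p a').2 j ≠ (p b).2 j
      · have hlt : (d ((p a').2 j) : ℚ) - α ((p a').1 j) < (d ((p b).2 j) : ℚ) - α ((p b).1 j) := by
          refine lt_of_le_of_ne hmono fun heq => ?_
          obtain ⟨h1, h2⟩ := gslope_injK hinj hd h01 h23 hlo heq
          rcases hch with h | h
          · exact h h1
          · exact h h2
        obtain ⟨d0, d1⟩ := psi_dropK hd h01 h23 hlo R hRnn hRlt hRup hReq P hP0 hP1 hP2 hlt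
        exact ⟨d0, fun _ hle => d1 hle⟩
      · push Not at hch
        obtain ⟨h1, h2⟩ := hch
        rw [h1, h2]
        exact ⟨le_rfl, fun hc _ => by rcases hc with hc | hc <;> exact absurd rfl hc⟩
    have hex : ∃ j, ((p a').1 j ≠ (p b).1 j ∨ (p a').2 j ≠ (p b).2 j) ∧ α ((p a').1 j) ≤ α ((p b).1 j) := by
      by_cases hrow : ∃ j, (p a').1 j ≠ (p b).1 j
      · have hsum : ∑ j, α ((p a').1 j) = ∑ j, α ((p b).1 j) := by
          rw [Equiv.sum_comp (p a').1 α, Equiv.sum_comp (p b).1 α]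
        by_contra hcon
        push Not at hcon
        have hle : ∀ j, α ((p b).1 j) ≤ α ((p a').1 j) := by
          intro j
          by_cases hj : (p a').1 j = (p b).1 j
          · rw [hj]
          · exact (hcon j (Or.inl hj)).le
        obtain ⟨j0, hj0⟩ := hrow
        have hlt0 : α ((p b).1 j0) < α ((p a').1 j0) := hcon j0 (Or.inl hj0)
        have : ∑ j, α ((p b).1 j) < ∑ j, α ((p a').1 j) :=
          sum_lt_sum (fun j _ => hle j) ⟨j0, mem_univ _, hlt0⟩
        linarith
      · push Not at hrow
        have hperm : (p a').1 = (p b).1 := Equiv.ext hrow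
        have hcls : (p a').2 ≠ (p b).2 := by
          intro hc
          exact hne k (Prod.ext hperm hc)
        obtain ⟨j, hj⟩ := Function.ne_iff.mp hcls
        exact ⟨j, Or.inr hj, by rw [hrow j]⟩
    obtain ⟨j0, hj0c, hj0a⟩ := hex
    have h0 : P ((p b).1 j0) ((p b).2 j0) + 1 ≤ P ((p a').1 j0) ((p a').2 j0) := (hcol j0).2 hj0c hj0a
    have hdiff : Φ a' - Φ b = ∑ j, (P ((p a').1 j) ((p a').2 j) - P ((p b).1 j) ((p b).2 j)) := by
      simp only [Φ, sum_sub_distrib]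
    have hge : (P ((p a').1 j0) ((p a').2 j0) - P ((p b).1 j0) ((p b).2 j0)) ≤
        ∑ j, (P ((p a').1 j) ((p a').2 j) - P ((p b).1 j) ((p b).2 j)) :=
      single_le_sum (f := fun j => P ((p a').1 j) ((p a').2 j) - P ((p b).1 j) ((p b).2 j))
        (fun j _ => by linarith [(hcol j).1]) (mem_univ j0)
    linarith
  have htel : ∀ k : Fin (n + 1), Φ k + (k : ℤ) ≤ Φ 0 := by
    intro k
    induction k using Fin.induction with
    | zero => simp
    | succ k ih =>
      have := hstep k
      have hv : ((k.succ : Fin (n + 1)) : ℤ) = ((k.castSucc : Fin (n + 1)) : ℤ) + 1 := by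
        simp [Fin.val_succ]
      rw [hv]; linarith
  have hlast := htel (Fin.last n)
  have h0 : Φ 0 ≤ (m : ℤ) * ((a : ℤ) * m + 2) := by
    calc Φ 0 = ∑ j, P ((p 0).1 j) ((p 0).2 j) := rfl
      _ ≤ ∑ _j : Fin m, ((a : ℤ) * m + 2) := sum_le_sum fun j _ => hPle _ _
      _ = (m : ℤ) * ((a : ℤ) * m + 2) := by rw [sum_const, card_univ, Fintype.card_fin]; ring
  have hnn : 0 ≤ Φ (Fin.last n) := sum_nonneg fun j _ => hPnn _ _
  have hl : ((Fin.last n : Fin (n + 1)) : ℤ) = n := by simp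
  rw [hl] at hlast
  have : (n : ℤ) ≤ (m : ℤ) * ((a : ℤ) * m + 2) := by linarith
  exact_mod_cast this

end SingleGauge

end Summit.ValiantsHypothesis.ValiantsHypothesis.Theorems.KPlusLogSqLaw
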